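import Literature.NumberTheory.Sieve.BombieriFriedlanderIwaniecPartition
import Literature.NumberTheory.Sieve.ShiuBrunTitchmarsh
import HarnessLib

/-!
# Bombieri–Friedlander–Iwaniec 1986: factorable moduli in dyadic blocks, and the sparse-piece bound

Trunk `AntSieve`, companion to `Literature.NumberTheory.Sieve.BombieriFriedlanderIwaniecPartition`.
Everything here is PROVED (the sparse-piece bound from the named fact
`Literature.NumberTheory.Sieve.BombieriFriedlanderIwaniecLemma3`, BFI §2 Lemma 3 p. 211).  For an interior box-tuple of §15
the moduli `d ≤ D` carry a well-factorable weight `λ = λ₁ ⋆ λ₂` (BFI §17, p. 249: "We apply Theorems 1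
and 2 with `R = x^{−ε}N` and `Q ≤ x^{4/7−4ε}N^{−1}`"); grouping `q ∼ Q''`, `r ∼ R''` dyadically turns
`∑_{d≤D, (d,a)=1} λ(d) Δ_{α⋆β}(d)` into a sum of `O(ℒ²)` dispersion sums `𝒟(M,N,Q'',R'')` of BFI (3.1)
plus (optionally) an initial segment `r ≤ R_c` kept aside for Theorem 0 (b):

* `Literature.NumberTheory.Sieve.BFI.sum_Icc_eq_sum_Icc_add_sum_dyadic` — `∑_{m ≤ y} = ∑_{m ≤ y/2^K} + ∑_{k<K} ∑_{m ∼ y/2^{k+1}}`.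
* `Literature.NumberTheory.Sieve.BFI.wellFactorable_sum_bilinDisc_eq` — the block decomposition just described.
* `Literature.NumberTheory.Sieve.BFI.sum_sum_le_sum_tau_mul` — `∑_{q≤Q} ∑_{r≤R} F(qr) ≤ ∑_{d ≤ QR} τ(d) F(d)` for `F ≥ 0`.
* `Literature.NumberTheory.Sieve.BFI.sum_tau_pow_abs_bilinDisc_le` — the TRIVIAL bound used to discard sparse pieces and as the
  `τ²`-weighted companion of Theorem 0 (b):
  `∑_{d ≤ D} τ(d)^w |Δ_{α⋆β}(d)| ≤ C M ℒ^B ∑_{n∼N} |β_n| τ(n)^B + (∑_{d≤D} τ(d)^w/φ(d)) ‖α‖₁ ‖β‖₁`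
  (count the `d ∣ mn − a`, then BFI Lemma 3 along the progression `mn ≡ 0 (mod n)`).
* `Literature.NumberTheory.Sieve.BFI.isSifted_of_rough_support` — (A₄) for `z`-rough-supported `β` once `ℒ^{B₀} < z`.

## References

* E. Bombieri, J. B. Friedlander, H. Iwaniec, Acta Math. 156 (1986), §2 Lemma 3 p. 211, §15 p. 246,
  §17 p. 249. [BombieriFriedlanderIwaniecActa1986]
-/

open Finset Real
open scoped ArithmeticFunction.sigma

namespace Literature.NumberTheory.Sieve

namespace BFI

/-! ### Dyadic partition with a remainder segment -/

/-- `∑_{1 ≤ m ≤ ⌊y⌋} f = ∑_{1 ≤ m ≤ ⌊y/2^K⌋} f + ∑_{k<K} ∑_{m ∼ y/2^{k+1}} f` for `y ≥ 0` and every `K`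
(iterate `sum_Icc_floor_eq_add_sum_dyadic`). [folklore] -/
theorem sum_Icc_eq_sum_Icc_add_sum_dyadic (f : ℕ → ℝ) {y : ℝ} (hy : 0 ≤ y) (K : ℕ) :
    ∑ m ∈ Icc 1 ⌊y⌋₊, f m =
      (∑ m ∈ Icc 1 ⌊y / 2 ^ K⌋₊, f m) + ∑ k ∈ Finset.range K, ∑ m ∈ dyadic (y / 2 ^ (k + 1)), f m := by
  induction K with
  | zero => simp
  | succ K ih =>
      rw [ih, Finset.sum_range_succ, sum_Icc_floor_eq_add_sum_dyadic f (by positivity : 0 ≤ y / 2 ^ K)]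
      rw [pow_succ, div_div]
      ring

/-! ### Reindexing a double sum by the product -/

/-- `∑_{q ≤ Q} ∑_{r ≤ R} F(qr) ≤ ∑_{d ≤ QR} τ(d) F(d)` for nonnegative `F` (each `d` arises from at most
`τ(d)` pairs). [folklore] -/
theorem sum_sum_le_sum_tau_mul (Q R : ℕ) {F : ℕ → ℝ} (hF : ∀ d, 0 ≤ F d) :
    ∑ q ∈ Icc 1 Q, ∑ r ∈ Icc 1 R, F (q * r) ≤ ∑ d ∈ Icc 1 (Q * R), (σ 0 d : ℝ) * F d := by
  rw [← Finset.sum_product']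
  -- group the pairs by their product
  have hmaps : ∀ p ∈ Icc 1 Q ×ˢ Icc 1 R, p.1 * p.2 ∈ Icc 1 (Q * R) := by
    intro p hp
    rw [Finset.mem_product, Finset.mem_Icc, Finset.mem_Icc] at hp
    rw [Finset.mem_Icc]
    exact ⟨Nat.one_le_iff_ne_zero.2 (mul_ne_zero (by omega) (by omega)), Nat.mul_le_mul hp.1.2 hp.2.2⟩
  rw [← Finset.sum_fiberwise_of_maps_to hmaps]
  refine Finset.sum_le_sum fun d hd => ?_
  rw [Finset.sum_filter]
  have hd0 : d ≠ 0 := by have := (Finset.mem_Icc.1 hd).1; omega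
  calc ∑ p ∈ Icc 1 Q ×ˢ Icc 1 R, (if p.1 * p.2 = d then F (p.1 * p.2) else 0)
      = ∑ p ∈ (Icc 1 Q ×ˢ Icc 1 R).filter (fun p => p.1 * p.2 = d), F d := by
        rw [Finset.sum_filter]
        refine Finset.sum_congr rfl fun p _ => ?_
        split_ifs with h
        · rw [h]
        · rfl
    _ = #((Icc 1 Q ×ˢ Icc 1 R).filter (fun p => p.1 * p.2 = d)) * F d := by
        rw [Finset.sum_const, nsmul_eq_mul]
    _ ≤ (σ 0 d : ℝ) * F d := by
        refine mul_le_mul_of_nonneg_right ?_ (hF d)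
        rw [ArithmeticFunction.sigma_zero_apply]
        -- inject the fiber into the divisors of `d` via the first coordinate
        have : #((Icc 1 Q ×ˢ Icc 1 R).filter (fun p => p.1 * p.2 = d)) ≤ #d.divisors := by
          refine Finset.card_le_card_of_injOn (fun p => p.1) (fun p hp => ?_) (fun p hp p' hp' h => ?_)
          · rw [Finset.mem_coe, Finset.mem_filter] at hp
            rw [Finset.mem_coe, Nat.mem_divisors]
            exact ⟨⟨p.2, hp.2.symm⟩, hd0⟩
          · rw [Finset.mem_coe, Finset.mem_filter] at hp hp'
            have h1 : p.1 ≠ 0 := by have := (Finset.mem_Icc.1 (Finset.mem_product.1 hp.1).1).1; omega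
            have h2 : p.2 = p'.2 := by
              apply Nat.eq_of_mul_eq_mul_left (Nat.pos_of_ne_zero h1)
              have e1 : p.1 * p.2 = d := hp.2
              have e2 : p'.1 * p'.2 = d := hp'.2
              have e3 : p.1 = p'.1 := h
              rw [e1, e3, e2]
            exact Prod.ext h h2
        exact_mod_cast this

/-! ### The block decomposition for well-factorable weights -/

/-- **Factorable moduli in dyadic blocks** (BFI §17, p. 249, as organised in §15): let `λ` be
well-factorable of level `D = D₁ D₂` (`D₁, D₂ ≥ 1`).  There are `λ₁, λ₂` (bounded by `1`, supported on
`[1, D₁]`, `[1, D₂]`) such that for all `a, M, N, α, β`, every `K₁` with `D₁ < 2^{K₁}` and every `K₂`,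
`∑_{d ≤ D, (d,a)=1} λ(d) Δ_{α⋆β}(d) = ∑_{q ≤ D₁} ∑_{r ≤ D₂/2^{K₂}} λ₁(q)λ₂(r) G(qr)
   + ∑_{k<K₁} ∑_{k'<K₂} 𝒟(M, N, D₁/2^{k+1}, D₂/2^{k'+1}; α, β, λ₁, λ₂)`,
where `G(d) = 1_{(d,a)=1} Δ_{α⋆β}(d)` and `𝒟` is `Literature.NumberTheory.Sieve.BFI.dispD`. [cite: BombieriFriedlanderIwaniecActa1986, §17 p. 249] -/
theorem wellFactorable_sum_bilinDisc_eq {D D₁ D₂ : ℝ} {lam : ℕ → ℝ} (h : IsWellFactorable D lam)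
    (hD₁ : 1 ≤ D₁) (hD₂ : 1 ≤ D₂) (hD : D₁ * D₂ = D) :
    ∃ lam₁ lam₂ : ArithmeticFunction ℝ,
      (∀ n, |lam₁ n| ≤ 1) ∧ (∀ n, |lam₂ n| ≤ 1) ∧
      (∀ n : ℕ, D₁ < n → lam₁ n = 0) ∧ (∀ n : ℕ, D₂ < n → lam₂ n = 0) ∧
      ∀ (a : ℤ) (M N : ℝ) (α β : ℕ → ℝ) (K₁ K₂ : ℕ), D₁ < 2 ^ K₁ →
        ∑ d ∈ (Icc 1 ⌊D⌋₊).filter (fun d : ℕ => IsCoprime (d : ℤ) a), lam d * bilinDisc a M N α β d =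
          (∑ q ∈ Icc 1 ⌊D₁⌋₊, ∑ r ∈ Icc 1 ⌊D₂ / 2 ^ K₂⌋₊,
              lam₁ q * lam₂ r * (if IsCoprime ((q * r : ℕ) : ℤ) a then bilinDisc a M N α β (q * r) else 0)) +
            ∑ k ∈ Finset.range K₁, ∑ k' ∈ Finset.range K₂,
              dispD a M N (D₁ / 2 ^ (k + 1)) (D₂ / 2 ^ (k' + 1)) α β lam₁ lam₂ := by
  obtain ⟨lam₁, lam₂, h1, h2, hs1, hs2, hsum⟩ := h.sum_mul_eq_sum_sum hD₁ hD₂ hD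
  refine ⟨lam₁, lam₂, h1, h2, hs1, hs2, fun a M N α β K₁ K₂ hK₁ => ?_⟩
  set G : ℕ → ℝ := fun d => if IsCoprime (d : ℤ) a then bilinDisc a M N α β d else 0 with hG
  have hLHS : ∑ d ∈ (Icc 1 ⌊D⌋₊).filter (fun d : ℕ => IsCoprime (d : ℤ) a), lam d * bilinDisc a M N α β d =
      ∑ d ∈ Icc 1 ⌊D⌋₊, lam d * G d := by
    rw [Finset.sum_filter]
    refine Finset.sum_congr rfl fun d _ => ?_
    simp only [hG]; split_ifs <;> simp
  rw [hLHS, hsum G]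
  -- split the `r`-range at `D₂ / 2^{K₂}` and the upper part into dyadic blocks; the `q`-range entirely
  have hD₂0 : 0 ≤ D₂ := by linarith
  have hD₁0 : 0 ≤ D₁ := by linarith
  have hr : ∀ q : ℕ, ∑ r ∈ Icc 1 ⌊D₂⌋₊, lam₁ q * lam₂ r * G (q * r) =
      (∑ r ∈ Icc 1 ⌊D₂ / 2 ^ K₂⌋₊, lam₁ q * lam₂ r * G (q * r)) +
        ∑ k' ∈ Finset.range K₂, ∑ r ∈ dyadic (D₂ / 2 ^ (k' + 1)), lam₁ q * lam₂ r * G (q * r) :=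
    fun q => sum_Icc_eq_sum_Icc_add_sum_dyadic _ hD₂0 K₂
  simp_rw [hr]
  rw [Finset.sum_add_distrib]
  congr 1
  -- the block part: reorder and decompose `q` dyadically
  rw [Finset.sum_comm]
  have hq : ∀ k' : ℕ, ∑ q ∈ Icc 1 ⌊D₁⌋₊, ∑ r ∈ dyadic (D₂ / 2 ^ (k' + 1)), lam₁ q * lam₂ r * G (q * r) =
      ∑ k ∈ Finset.range K₁, ∑ q ∈ dyadic (D₁ / 2 ^ (k + 1)),
        ∑ r ∈ dyadic (D₂ / 2 ^ (k' + 1)), lam₁ q * lam₂ r * G (q * r) :=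
    fun k' => sum_Icc_eq_sum_range_sum_dyadic _ hD₁0 hK₁
  simp_rw [hq]
  rw [Finset.sum_comm]
  refine Finset.sum_congr rfl fun k _ => Finset.sum_congr rfl fun k' _ => ?_
  rw [dispD_eq_sum_bilinDisc]
  refine Finset.sum_congr rfl fun q _ => Finset.sum_congr rfl fun r _ => ?_
  simp only [hG]
  split_ifs <;> ring

/-! ### (A₄) for rough-supported sequences -/

/-- A sequence supported on `z`-rough integers satisfies BFI's (A₄) with any `N₀ < z`.
[cite: BombieriFriedlanderIwaniecActa1986, §6 (A₄) p. 220] -/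
theorem isSifted_of_rough_support {β : ℕ → ℝ} {z N₀ : ℝ} (hz : N₀ < z) (S : Finset ℕ)
    (hβ0 : β 0 = 0) (hβ : ∀ n, β n ≠ 0 → IsRough z n) : IsSifted S N₀ β := by
  intro n _ hp
  by_contra hne
  obtain ⟨p, hp, hpn, hpN⟩ := hp
  rcases eq_or_ne n 0 with rfl | hn0
  · exact hne hβ0
  · have hmem : p ∈ n.primeFactors := Nat.mem_primeFactors.2 ⟨hp, hpn, hn0⟩
    exact absurd hpN (not_le.2 (lt_of_lt_of_le hz (hβ n hne p hmem)))

/-! ### The trivial bound for the brackets, with divisor weights (via BFI Lemma 3) -/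

/-- `|Δ_{α⋆β}(d)| ≤ ∑_{n∼N} |β_n| ∑_{m∼M, d ∣ mn−a} |α_m| + ‖α‖₁‖β‖₁/φ(d)` for `d ≥ 1`. [folklore] -/
theorem abs_bilinDisc_le (a : ℤ) (M N : ℝ) (α β : ℕ → ℝ) {d : ℕ} (hd : 1 ≤ d) :
    |bilinDisc a M N α β d| ≤
      (∑ n ∈ dyadic N, |β n| * ∑ m ∈ (dyadic M).filter (fun m : ℕ => (d : ℤ) ∣ (m : ℤ) * n - a), |α m|) +
        (∑ m ∈ dyadic M, |α m|) * (∑ n ∈ dyadic N, |β n|) / (Nat.totient d : ℝ) := by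
  haveI : NeZero d := ⟨by omega⟩
  have hφ : (0 : ℝ) < Nat.totient d := by exact_mod_cast Nat.totient_pos.2 hd
  unfold bilinDisc
  refine (abs_sub _ _).trans (add_le_add ?_ ?_)
  · calc |∑ m ∈ dyadic M, ∑ n ∈ dyadic N, if ((m * n : ℕ) : ZMod d) = (a : ZMod d) then α m * β n else 0|
        ≤ ∑ m ∈ dyadic M, ∑ n ∈ dyadic N, |if ((m * n : ℕ) : ZMod d) = (a : ZMod d) then α m * β n else 0| :=
          (Finset.abs_sum_le_sum_abs _ _).trans (Finset.sum_le_sum fun m _ => Finset.abs_sum_le_sum_abs _ _)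
      _ = ∑ n ∈ dyadic N, ∑ m ∈ dyadic M, |if ((m * n : ℕ) : ZMod d) = (a : ZMod d) then α m * β n else 0| :=
          Finset.sum_comm
      _ = ∑ n ∈ dyadic N, |β n| * ∑ m ∈ (dyadic M).filter (fun m : ℕ => (d : ℤ) ∣ (m : ℤ) * n - a), |α m| := by
          refine Finset.sum_congr rfl fun n _ => ?_
          rw [Finset.mul_sum, Finset.sum_filter]
          refine Finset.sum_congr rfl fun m _ => ?_
          have hiff : (((m * n : ℕ) : ZMod d) = (a : ZMod d)) ↔ ((d : ℤ) ∣ (m : ℤ) * n - a) := by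
            rw [show ((m * n : ℕ) : ZMod d) = (((m : ℤ) * n : ℤ) : ZMod d) by push_cast; ring,
              ZMod.intCast_eq_intCast_iff_dvd_sub]
            rw [dvd_sub_comm]
          by_cases h : ((m * n : ℕ) : ZMod d) = (a : ZMod d)
          · rw [if_pos h, if_pos (hiff.1 h), abs_mul, mul_comm]
          · rw [if_neg h, if_neg (fun h' => h (hiff.2 h'))]; simp
  · rw [abs_div, abs_of_pos hφ]
    refine div_le_div_of_nonneg_right ?_ hφ.le
    calc |∑ m ∈ dyadic M, ∑ n ∈ dyadic N, if (m * n).Coprime d then α m * β n else 0|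
        ≤ ∑ m ∈ dyadic M, ∑ n ∈ dyadic N, |if (m * n).Coprime d then α m * β n else 0| :=
          (Finset.abs_sum_le_sum_abs _ _).trans (Finset.sum_le_sum fun m _ => Finset.abs_sum_le_sum_abs _ _)
      _ ≤ ∑ m ∈ dyadic M, ∑ n ∈ dyadic N, |α m| * |β n| := by
          refine Finset.sum_le_sum fun m _ => Finset.sum_le_sum fun n _ => ?_
          split_ifs
          · rw [abs_mul]
          · rw [abs_zero]; positivity
      _ = (∑ m ∈ dyadic M, |α m|) * ∑ n ∈ dyadic N, |β n| := by rw [Finset.sum_mul_sum]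

/-- `∑_{1 ≤ d ≤ D, d ∣ k} τ(d)^w ≤ τ(k)^{w+1}` for `k ≠ 0`. [folklore] -/
theorem sum_sigma_zero_pow_filter_dvd_le (Dn w : ℕ) {k : ℕ} (hk : k ≠ 0) :
    ∑ d ∈ (Icc 1 Dn).filter (fun d : ℕ => d ∣ k), (σ 0 d : ℝ) ^ w ≤ (σ 0 k : ℝ) ^ (w + 1) := by
  calc ∑ d ∈ (Icc 1 Dn).filter (fun d : ℕ => d ∣ k), (σ 0 d : ℝ) ^ w
      ≤ ∑ d ∈ k.divisors, (σ 0 d : ℝ) ^ w := by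
        refine Finset.sum_le_sum_of_subset_of_nonneg (fun d hd => ?_) fun _ _ _ => by positivity
        exact Nat.mem_divisors.2 ⟨(Finset.mem_filter.1 hd).2, hk⟩
    _ ≤ ∑ d ∈ k.divisors, (σ 0 k : ℝ) ^ w := by
        refine Finset.sum_le_sum fun d hd => ?_
        exact pow_le_pow_left₀ (Nat.cast_nonneg _)
          (by exact_mod_cast sigma_zero_le_of_dvd hk (Nat.dvd_of_mem_divisors hd)) w
    _ = (σ 0 k : ℝ) ^ (w + 1) := by
        rw [Finset.sum_const, nsmul_eq_mul, ← ArithmeticFunction.sigma_zero_apply, pow_succ, mul_comm]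

/-- **The trivial bound for the brackets of BFI (3.1), summed over the moduli with a divisor weight**
(used to discard sparse pieces, and — with `w = 2` — as the companion of Theorem 0 (b) in a Cauchy
inequality).  From the named fact `BombieriFriedlanderIwaniecLemma3`: for `a ≠ 0` and exponents
`c_α, w` there are `B, C ≥ 0`, `x₀` such that for `x' ≥ x₀`, `M N = x'` with `1 ≤ N`, `4N² ≤ x'`, all
`α` on `m ∼ M` with `|α| ≤ τ^{c_α}`, all `β` on `n ∼ N` and every `D`:
`∑_{d ≤ D} τ(d)^w |Δ_{α⋆β}(d)| ≤ C M (log x')^B ∑_{n∼N} |β_n| τ(n)^B + (∑_{d≤D} τ(d)^w/φ(d)) ‖α‖₁ ‖β‖₁`.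
(Count the `d ∣ mn − a`: at most `τ(mn−a)^{w+1}` in weight; then Lemma 3 along `mn ≡ 0 (mod n)`.)
[cite: BombieriFriedlanderIwaniecActa1986, §2 Lemma 3 p. 211] -/
theorem sum_tau_pow_abs_bilinDisc_le (hL3 : BombieriFriedlanderIwaniecLemma3) {a : ℤ} (ha : a ≠ 0)
    (cα w : ℕ) :
    ∃ B C x₀ : ℝ, 0 ≤ B ∧ 0 ≤ C ∧ ∀ x' M N : ℝ, x₀ ≤ x' → 1 ≤ N → 4 * N ^ 2 ≤ x' → M * N = x' →
      ∀ α β : ℕ → ℝ, (∀ m, |α m| ≤ (σ 0 m : ℝ) ^ cα) → (∀ m, α m ≠ 0 → m ∈ dyadic M) →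
      (∀ n, β n ≠ 0 → n ∈ dyadic N) → ∀ Dn : ℕ,
        ∑ d ∈ Icc 1 Dn, (σ 0 d : ℝ) ^ w * |bilinDisc a M N α β d| ≤
          C * M * Real.log x' ^ B * (∑ n ∈ dyadic N, |β n| * (σ 0 n : ℝ) ^ B) +
            (∑ d ∈ Icc 1 Dn, (σ 0 d : ℝ) ^ w / (Nat.totient d : ℝ)) *
              (∑ m ∈ dyadic M, |α m|) * (∑ n ∈ dyadic N, |β n|) := by
  set A : ℝ := max (cα : ℝ) ((w : ℝ) + 1) with hA
  have hA0 : 0 < A := lt_of_lt_of_le (by positivity) (le_max_right _ _)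
  obtain ⟨B, C, x₀, hL⟩ := hL3 a ha A hA0 (1 / 2) (by norm_num)
  -- normalise `B, C ≥ 0` and `x₀ ≥ max (|a| + 1) 4`
  set B' : ℝ := max B 0 with hB'
  set C' : ℝ := max C 0 with hC'
  set x₁ : ℝ := max x₀ (max ((|a| : ℝ) + 1) 4) with hx₁
  refine ⟨B', 2 * 2 ^ B' * C', x₁, le_max_right _ _, by positivity, ?_⟩
  intro x' M N hx' hN1 hN4 hMN α β hα hαs hβs Dn
  have hx₀ : x₀ ≤ x' := (le_max_left _ _).trans hx'
  have hxa : (|a| : ℝ) + 1 ≤ x' := le_trans (le_trans (le_max_left _ _) (le_max_right _ _)) hx'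
  have hx4 : (4 : ℝ) ≤ x' := le_trans (le_trans (le_max_right _ _) (le_max_right _ _)) hx'
  have hx'0 : 0 < x' := by linarith
  have hN0 : 0 < N := by linarith
  have hM0 : 0 < M := by
    have : 0 < M * N := by rw [hMN]; exact hx'0
    exact pos_of_mul_pos_left this hN0.le  |> fun h => by nlinarith [this]
  have hM0' : 0 ≤ M := hM0.le
  have hlogx : 1 ≤ Real.log x' := by
    rw [← Real.log_exp 1]; refine Real.log_le_log (Real.exp_pos 1) ?_
    have := Real.exp_one_lt_d9; linarith
  -- Step 1: the bracket bound and the divisor count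
  have hstep1 : ∑ d ∈ Icc 1 Dn, (σ 0 d : ℝ) ^ w * |bilinDisc a M N α β d| ≤
      (∑ n ∈ dyadic N, |β n| * ∑ m ∈ dyadic M, |α m| * (σ 0 (((m : ℤ) * n - a).toNat) : ℝ) ^ (w + 1)) +
        (∑ d ∈ Icc 1 Dn, (σ 0 d : ℝ) ^ w / (Nat.totient d : ℝ)) *
          (∑ m ∈ dyadic M, |α m|) * (∑ n ∈ dyadic N, |β n|) := by
    calc ∑ d ∈ Icc 1 Dn, (σ 0 d : ℝ) ^ w * |bilinDisc a M N α β d|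
        ≤ ∑ d ∈ Icc 1 Dn, (σ 0 d : ℝ) ^ w *
            ((∑ n ∈ dyadic N, |β n| * ∑ m ∈ (dyadic M).filter (fun m : ℕ => (d : ℤ) ∣ (m : ℤ) * n - a), |α m|) +
              (∑ m ∈ dyadic M, |α m|) * (∑ n ∈ dyadic N, |β n|) / (Nat.totient d : ℝ)) := by
          refine Finset.sum_le_sum fun d hd => ?_
          exact mul_le_mul_of_nonneg_left (abs_bilinDisc_le a M N α β (Finset.mem_Icc.1 hd).1) (by positivity)
      _ = (∑ n ∈ dyadic N, |β n| * ∑ m ∈ dyadic M, |α m| *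
            ∑ d ∈ (Icc 1 Dn).filter (fun d : ℕ => (d : ℤ) ∣ (m : ℤ) * n - a), (σ 0 d : ℝ) ^ w) +
          (∑ d ∈ Icc 1 Dn, (σ 0 d : ℝ) ^ w / (Nat.totient d : ℝ)) *
            (∑ m ∈ dyadic M, |α m|) * (∑ n ∈ dyadic N, |β n|) := by
          rw [Finset.sum_congr rfl fun d _ => mul_add _ _ _, Finset.sum_add_distrib]
          congr 1
          · -- swap `d` innermost
            calc ∑ d ∈ Icc 1 Dn, (σ 0 d : ℝ) ^ w *
                  ∑ n ∈ dyadic N, |β n| * ∑ m ∈ (dyadic M).filter (fun m : ℕ => (d : ℤ) ∣ (m : ℤ) * n - a), |α m|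
                = ∑ d ∈ Icc 1 Dn, ∑ n ∈ dyadic N, ∑ m ∈ dyadic M,
                    |β n| * (|α m| * if (d : ℤ) ∣ (m : ℤ) * n - a then (σ 0 d : ℝ) ^ w else 0) := by
                  refine Finset.sum_congr rfl fun d _ => ?_
                  rw [Finset.mul_sum]
                  refine Finset.sum_congr rfl fun n _ => ?_
                  rw [Finset.sum_filter, Finset.mul_sum, Finset.mul_sum]
                  refine Finset.sum_congr rfl fun m _ => ?_
                  split_ifs <;> ring
              _ = ∑ n ∈ dyadic N, ∑ m ∈ dyadic M, ∑ d ∈ Icc 1 Dn,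
                    |β n| * (|α m| * if (d : ℤ) ∣ (m : ℤ) * n - a then (σ 0 d : ℝ) ^ w else 0) := by
                  rw [Finset.sum_comm]
                  refine Finset.sum_congr rfl fun n _ => ?_
                  rw [Finset.sum_comm]
              _ = _ := by
                  refine Finset.sum_congr rfl fun n _ => ?_
                  rw [Finset.mul_sum]
                  refine Finset.sum_congr rfl fun m _ => ?_
                  rw [Finset.mul_sum, Finset.sum_filter, Finset.mul_sum]
                  refine Finset.sum_congr rfl fun d _ => ?_
                  split_ifs <;> ring
          · conv_rhs => rw [Finset.sum_mul, Finset.sum_mul]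
            refine Finset.sum_congr rfl fun d _ => ?_
            ring
      _ ≤ _ := by
          refine add_le_add (Finset.sum_le_sum fun n hn => ?_) le_rfl
          refine mul_le_mul_of_nonneg_left (Finset.sum_le_sum fun m hm => ?_) (abs_nonneg _)
          refine mul_le_mul_of_nonneg_left ?_ (abs_nonneg _)
          -- `d ∣ mn - a` in `ℤ` iff `d ∣ (mn - a).toNat`, and `mn - a > 0`
          have hm : (M : ℝ) < m := ((mem_dyadic hM0').1 hm).1
          have hn : (N : ℝ) < n := ((mem_dyadic hN0.le).1 hn).1
          have hmn : (|a| : ℝ) < (m : ℝ) * n := by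
            have : M * N < (m : ℝ) * n := mul_lt_mul'' hm hn hM0' hN0.le
            rw [hMN] at this; linarith
          have hk0 : 0 < (m : ℤ) * n - a := by
            have h2 : ((|a| : ℤ) : ℝ) < ((m : ℤ) * n : ℤ) := by
              rw [Int.cast_abs, Int.cast_mul, Int.cast_natCast, Int.cast_natCast]; exact hmn
            have h3 : |a| < (m : ℤ) * n := by exact_mod_cast h2
            linarith [le_abs_self a]
          set k := ((m : ℤ) * n - a).toNat with hk
          have hkZ : ((m : ℤ) * n - a) = (k : ℤ) := by rw [hk, Int.toNat_of_nonneg hk0.le]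
          have hk0' : k ≠ 0 := by
            intro h; rw [h] at hkZ; simp at hkZ; linarith
          have hset : (Icc 1 Dn).filter (fun d : ℕ => (d : ℤ) ∣ (m : ℤ) * n - a) =
              (Icc 1 Dn).filter (fun d : ℕ => d ∣ k) := by
            refine Finset.filter_congr fun d _ => ?_
            rw [hkZ, Int.natCast_dvd_natCast]
          rw [hset]
          exact sum_sigma_zero_pow_filter_dvd_le Dn w hk0'
  refine hstep1.trans (add_le_add ?_ le_rfl)
  -- Step 2: Lemma 3 along `mn ≡ 0 (mod n)` for each `n ∼ N`
  rw [Finset.mul_sum]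
  refine Finset.sum_le_sum fun n hn => ?_
  have hnN : (N : ℝ) < n := ((mem_dyadic hN0.le).1 hn).1
  have hn2N : (n : ℝ) ≤ 2 * N := ((mem_dyadic hN0.le).1 hn).2
  have hn0 : 0 < n := pos_of_mem_dyadic hN0.le hn
  have hn0' : (0 : ℝ) < n := by exact_mod_cast hn0
  haveI : NeZero n := ⟨hn0.ne'⟩
  -- parameters of Lemma 3: `x := 2 M n`, modulus `n`, class `0`
  set X : ℝ := 2 * M * n with hX
  have hXx : 2 * x' ≤ X := by
    rw [hX, ← hMN]; nlinarith
  have hX₀ : x₀ ≤ X := by linarith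
  have hX4 : X ≤ 4 * x' := by rw [hX, ← hMN]; nlinarith
  have hnX : (n : ℝ) ≤ X ^ (1 - 1 / 2 : ℝ) := by
    rw [show (1 - 1 / 2 : ℝ) = 1 / 2 by norm_num, ← Real.sqrt_eq_rpow]
    refine Real.le_sqrt_of_sq_le ?_
    -- `n² ≤ 4N² ≤ x' ≤ X`? No: use `n ≤ 2N` and `4 N² ≤ x' = MN ≤ M n`, so `n² ≤ 4N² ≤ x' ≤ 2Mn ≤ X`.
    nlinarith
  have hL3n := hL X hX₀ n (Nat.one_le_iff_ne_zero.2 hn0.ne') hnX (0 : ZMod n)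
  -- compare our sum with Lemma 3's sum through `m ↦ m n`
  have hinj : ∀ m ∈ dyadic M, ∀ m' ∈ dyadic M, m * n = m' * n → m = m' :=
    fun m _ m' _ h => Nat.eq_of_mul_eq_mul_right hn0 h
  have hsub : (dyadic M).image (fun m => m * n) ⊆
      (Icc 1 ⌊X⌋₊).filter (fun k' : ℕ => |a| < (k' : ℤ) ∧ (k' : ZMod n) = 0) := by
    intro k' hk'
    obtain ⟨m, hm, rfl⟩ := Finset.mem_image.1 hk'
    have hmM : (M : ℝ) < m := ((mem_dyadic hM0').1 hm).1
    have hm2M : (m : ℝ) ≤ 2 * M := ((mem_dyadic hM0').1 hm).2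
    have hm0 : 0 < m := pos_of_mem_dyadic hM0' hm
    refine Finset.mem_filter.2 ⟨Finset.mem_Icc.2 ⟨Nat.one_le_iff_ne_zero.2 (mul_ne_zero hm0.ne' hn0.ne'),
      Nat.le_floor ?_⟩, ?_, ?_⟩
    · push_cast; rw [hX]; nlinarith
    · have h1 : (|a| : ℝ) < (m : ℝ) * n := by
        have : M * N < (m : ℝ) * n := mul_lt_mul'' hmM hnN hM0' hN0.le
        rw [hMN] at this; linarith
      have h2 : ((|a| : ℤ) : ℝ) < (((m * n : ℕ) : ℤ) : ℝ) := by
        rw [Int.cast_abs, Int.cast_natCast, Nat.cast_mul]; exact h1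
      exact_mod_cast h2
    · push_cast; simp
  -- the summands: `|α m| τ(mn−a)^{w+1} ≤ τ(mn)^A τ(mn − a)^A`
  have hterm : ∀ m ∈ dyadic M,
      |α m| * (σ 0 (((m : ℤ) * n - a).toNat) : ℝ) ^ (w + 1) ≤
        (σ 0 (m * n) : ℝ) ^ A * (σ 0 (((m * n : ℕ) : ℤ) - a).toNat : ℝ) ^ A := by
    intro m hm
    have hm0 : m ≠ 0 := (pos_of_mem_dyadic hM0' hm).ne'
    have hmn0 : m * n ≠ 0 := mul_ne_zero hm0 hn0.ne'
    have hτm : (σ 0 m : ℝ) ≤ σ 0 (m * n) := by exact_mod_cast sigma_zero_le_of_dvd hmn0 (dvd_mul_right m n)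
    have hτ1 : (1 : ℝ) ≤ σ 0 (m * n) := by exact_mod_cast one_le_sigma_zero hmn0
    have hk : ((m : ℤ) * n - a) = (((m * n : ℕ) : ℤ) - a) := by push_cast; ring
    rw [hk]
    set t : ℝ := (σ 0 (((m * n : ℕ) : ℤ) - a).toNat : ℝ) with ht
    have ht0 : 0 ≤ t := Nat.cast_nonneg _
    refine mul_le_mul ?_ ?_ (by positivity) (by positivity)
    · calc |α m| ≤ (σ 0 m : ℝ) ^ cα := hα m
        _ ≤ (σ 0 (m * n) : ℝ) ^ cα := pow_le_pow_left₀ (Nat.cast_nonneg _) hτm cα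
        _ = (σ 0 (m * n) : ℝ) ^ (cα : ℝ) := (Real.rpow_natCast _ cα).symm
        _ ≤ (σ 0 (m * n) : ℝ) ^ A := Real.rpow_le_rpow_of_exponent_le hτ1 (le_max_left _ _)
    · rcases eq_or_lt_of_le ht0 with h0 | hpos
      · rw [← h0]
        rw [Real.zero_rpow hA0.ne', zero_pow (Nat.succ_ne_zero w)]
      · by_cases ht1 : 1 ≤ t
        · calc t ^ (w + 1) = t ^ ((w : ℝ) + 1) := by rw [← Real.rpow_natCast]; push_cast; ring_nf
            _ ≤ t ^ A := Real.rpow_le_rpow_of_exponent_le ht1 (le_max_right _ _)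
        · -- `0 < t < 1` impossible for `τ`, but harmless: `τ(k) ≥ 1` for `k ≠ 0`, and `k = 0` gives `t = 0`
          exfalso
          rw [not_le] at ht1
          have : (((m * n : ℕ) : ℤ) - a).toNat ≠ 0 := by
            intro h; rw [ht, h] at hpos; simp at hpos
          have h1 : (1 : ℝ) ≤ t := by rw [ht]; exact_mod_cast one_le_sigma_zero this
          linarith
  calc |β n| * ∑ m ∈ dyadic M, |α m| * (σ 0 (((m : ℤ) * n - a).toNat) : ℝ) ^ (w + 1)
      ≤ |β n| * ∑ m ∈ dyadic M, (σ 0 (m * n) : ℝ) ^ A * (σ 0 (((m * n : ℕ) : ℤ) - a).toNat : ℝ) ^ A :=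
        mul_le_mul_of_nonneg_left (Finset.sum_le_sum hterm) (abs_nonneg _)
    _ = |β n| * ∑ k' ∈ (dyadic M).image (fun m => m * n),
          (σ 0 k' : ℝ) ^ A * (σ 0 (((k' : ℕ) : ℤ) - a).toNat : ℝ) ^ A := by
        rw [Finset.sum_image hinj]
    _ ≤ |β n| * ∑ k' ∈ (Icc 1 ⌊X⌋₊).filter (fun k' : ℕ => |a| < (k' : ℤ) ∧ (k' : ZMod n) = 0),
          (σ 0 k' : ℝ) ^ A * (σ 0 (((k' : ℕ) : ℤ) - a).toNat : ℝ) ^ A :=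
        mul_le_mul_of_nonneg_left (Finset.sum_le_sum_of_subset_of_nonneg hsub fun _ _ _ => by positivity)
          (abs_nonneg _)
    _ ≤ |β n| * (C * (X / n) * ((σ 0 n : ℝ) * Real.log X) ^ B) := mul_le_mul_of_nonneg_left hL3n (abs_nonneg _)
    _ ≤ |β n| * (C' * (2 * M) * ((σ 0 n : ℝ) * (2 * Real.log x')) ^ B') := by
        refine mul_le_mul_of_nonneg_left ?_ (abs_nonneg _)
        have hXn : X / n = 2 * M := by rw [hX]; field_simp
        rw [hXn]
        have hτn : (1 : ℝ) ≤ σ 0 n := by exact_mod_cast one_le_sigma_zero hn0.ne'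
        have hlogX : Real.log X ≤ 2 * Real.log x' := by
          calc Real.log X ≤ Real.log (4 * x') := Real.log_le_log (by positivity) hX4
            _ = Real.log 4 + Real.log x' := Real.log_mul (by norm_num) hx'0.ne'
            _ ≤ 2 * Real.log x' := by
                have : Real.log 4 ≤ Real.log x' := Real.log_le_log (by norm_num) hx4
                linarith
        have hlogX1 : 1 ≤ Real.log X := hlogx.trans (Real.log_le_log hx'0 (by linarith))
        have hbase1 : 1 ≤ (σ 0 n : ℝ) * Real.log X := by nlinarith
        calc C * (2 * M) * ((σ 0 n : ℝ) * Real.log X) ^ B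
            ≤ C' * (2 * M) * ((σ 0 n : ℝ) * Real.log X) ^ B :=
              mul_le_mul_of_nonneg_right (mul_le_mul_of_nonneg_right (le_max_left _ _) (by positivity))
                (by positivity)
          _ ≤ C' * (2 * M) * ((σ 0 n : ℝ) * Real.log X) ^ B' :=
              mul_le_mul_of_nonneg_left (Real.rpow_le_rpow_of_exponent_le hbase1 (le_max_left _ _))
                (by positivity)
          _ ≤ C' * (2 * M) * ((σ 0 n : ℝ) * (2 * Real.log x')) ^ B' := by
              refine mul_le_mul_of_nonneg_left ?_ (by positivity)
              exact Real.rpow_le_rpow (by positivity) (mul_le_mul_of_nonneg_left hlogX (by positivity))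
                (le_max_right _ _)
    _ = 2 * 2 ^ B' * C' * M * Real.log x' ^ B' * (|β n| * (σ 0 n : ℝ) ^ B') := by
        rw [Real.mul_rpow (Nat.cast_nonneg _) (by positivity), Real.mul_rpow (by norm_num) (by linarith)]
        ring


/-! ### Theorem 0 (b) for a fixed residue, and the recombination of the small moduli -/

/-- **Theorem 0 (b) for a fixed residue `a`**, summed over the moduli `q ≤ Q` prime to `a` (the
printed statement takes `max_{(a,q)=1}`; here the family `a_q` is `a` when `(q,a)=1` and `1`
otherwise, and the moduli not prime to `a` are dropped by nonnegativity).
[cite: BombieriFriedlanderIwaniecActa1986, §2 Theorem 0 (b) p. 211] -/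
theorem _root_.Literature.NumberTheory.Sieve.BombieriFriedlanderIwaniecTheorem0b.sum_filter_coprime_le
    (h : BombieriFriedlanderIwaniecTheorem0b) {ε : ℝ} (hε : 0 < ε) {A : ℝ} (hA : 0 < A) {B : ℝ}
    (hB : 0 ≤ B) (Csw : ℝ → ℝ) :
    ∃ B₁ C x₀ : ℝ, 0 < B₁ ∧ ∀ x : ℝ, x₀ ≤ x → ∀ M N : ℝ,
      M * N = x → x ^ ε ≤ N → N ≤ x ^ (1 - ε) →
      ∀ β : ℕ → ℝ, SiegelWalfiszHyp N B Csw β → ∀ α : ℕ → ℝ,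
      ∀ Q : ℝ, Q ≤ x ^ (1 / 2 : ℝ) / Real.log x ^ B₁ → ∀ a : ℤ,
        ∑ q ∈ (Icc 1 ⌊Q⌋₊).filter (fun q : ℕ => IsCoprime (q : ℤ) a), |bilinDisc a M N α β q| ≤
          C * Real.sqrt (l2Sq M α) * Real.sqrt (l2Sq N β) * x ^ (1 / 2 : ℝ) / Real.log x ^ A := by
  obtain ⟨B₁, C, x₀, hB₁, hC⟩ := h ε hε A hA B hB Csw
  refine ⟨B₁, C, x₀, hB₁, fun x hx M N hMN hN1 hN2 β hβ α Q hQ a => ?_⟩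
  classical
  set a' : ℕ → ℤ := fun q => if IsCoprime (q : ℤ) a then a else 1 with ha'
  have hcop : ∀ q : ℕ, IsCoprime (q : ℤ) (a' q) := by
    intro q
    simp only [ha']
    split_ifs with hq
    · exact hq
    · exact isCoprime_one_right
  calc ∑ q ∈ (Icc 1 ⌊Q⌋₊).filter (fun q : ℕ => IsCoprime (q : ℤ) a), |bilinDisc a M N α β q|
      = ∑ q ∈ (Icc 1 ⌊Q⌋₊).filter (fun q : ℕ => IsCoprime (q : ℤ) a), |bilinDisc (a' q) M N α β q| := by
        refine Finset.sum_congr rfl fun q hq => ?_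
        rw [Finset.mem_filter] at hq
        simp only [ha', if_pos hq.2]
    _ ≤ ∑ q ∈ Icc 1 ⌊Q⌋₊, |bilinDisc (a' q) M N α β q| :=
        Finset.sum_le_sum_of_subset_of_nonneg (Finset.filter_subset _ _) fun _ _ _ => abs_nonneg _
    _ ≤ _ := hC x hx M N hMN hN1 hN2 β hβ α Q hQ a' hcop

/-- **Recombining the small moduli** (the part `r ≤ R_c` kept aside for Theorem 0 (b)): for
`|λ₁|, |λ₂| ≤ 1`,
`|∑_{q≤Q} ∑_{r≤R} λ₁(q)λ₂(r) 1_{(qr,a)=1} G(qr)| ≤ ∑_{d ≤ QR, (d,a)=1} τ(d) |G(d)|`. [folklore] -/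
theorem abs_sum_sum_mul_ite_le {lam₁ lam₂ : ℕ → ℝ} (h1 : ∀ n, |lam₁ n| ≤ 1) (h2 : ∀ n, |lam₂ n| ≤ 1)
    (Q R : ℕ) (a : ℤ) (G : ℕ → ℝ) :
    |∑ q ∈ Icc 1 Q, ∑ r ∈ Icc 1 R,
        lam₁ q * lam₂ r * (if IsCoprime ((q * r : ℕ) : ℤ) a then G (q * r) else 0)| ≤
      ∑ d ∈ (Icc 1 (Q * R)).filter (fun d : ℕ => IsCoprime (d : ℤ) a), (σ 0 d : ℝ) * |G d| := by
  classical
  set F : ℕ → ℝ := fun d => if IsCoprime (d : ℤ) a then |G d| else 0 with hF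
  have hF0 : ∀ d, 0 ≤ F d := fun d => by simp only [hF]; split_ifs <;> simp
  calc |∑ q ∈ Icc 1 Q, ∑ r ∈ Icc 1 R,
          lam₁ q * lam₂ r * (if IsCoprime ((q * r : ℕ) : ℤ) a then G (q * r) else 0)|
      ≤ ∑ q ∈ Icc 1 Q, ∑ r ∈ Icc 1 R,
          |lam₁ q * lam₂ r * (if IsCoprime ((q * r : ℕ) : ℤ) a then G (q * r) else 0)| :=
        (Finset.abs_sum_le_sum_abs _ _).trans (Finset.sum_le_sum fun _ _ => Finset.abs_sum_le_sum_abs _ _)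
    _ ≤ ∑ q ∈ Icc 1 Q, ∑ r ∈ Icc 1 R, F (q * r) := by
        refine Finset.sum_le_sum fun q _ => Finset.sum_le_sum fun r _ => ?_
        simp only [hF]
        rw [abs_mul, abs_mul]
        split_ifs with hc
        · have h12 : |lam₁ q| * |lam₂ r| ≤ 1 := by
            calc |lam₁ q| * |lam₂ r| ≤ 1 * 1 :=
                  mul_le_mul (h1 q) (h2 r) (abs_nonneg _) zero_le_one
              _ = 1 := one_mul 1
          calc |lam₁ q| * |lam₂ r| * |G (q * r)| ≤ 1 * |G (q * r)| :=
                mul_le_mul_of_nonneg_right h12 (abs_nonneg _)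
            _ = |G (q * r)| := one_mul _
        · simp
    _ ≤ ∑ d ∈ Icc 1 (Q * R), (σ 0 d : ℝ) * F d := sum_sum_le_sum_tau_mul Q R hF0
    _ = _ := by
        rw [Finset.sum_filter]
        refine Finset.sum_congr rfl fun d _ => ?_
        simp only [hF]
        split_ifs <;> simp

/-- **Cauchy–Schwarz for the `τ`-weighted sum**:
`∑_{d∈s} τ(d) |G(d)| ≤ (∑_{d∈s} τ(d)² |G(d)|)^{1/2} (∑_{d∈s} |G(d)|)^{1/2}`. [folklore] -/
theorem sum_tau_mul_abs_le_sqrt (s : Finset ℕ) (G : ℕ → ℝ) :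
    ∑ d ∈ s, (σ 0 d : ℝ) * |G d| ≤
      Real.sqrt (∑ d ∈ s, (σ 0 d : ℝ) ^ 2 * |G d|) * Real.sqrt (∑ d ∈ s, |G d|) := by
  have h := Real.sum_sqrt_mul_sqrt_le s (f := fun d => (σ 0 d : ℝ) ^ 2 * |G d|) (g := fun d => |G d|)
    (fun d => mul_nonneg (sq_nonneg _) (abs_nonneg _)) (fun d => abs_nonneg _)
  refine le_trans (le_of_eq ?_) h
  refine Finset.sum_congr rfl fun d _ => ?_
  rw [Real.sqrt_mul (sq_nonneg _), Real.sqrt_sq (by positivity), mul_assoc,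
    Real.mul_self_sqrt (abs_nonneg _)]

/-! ### Divisor-power moments over a dyadic range -/

/-- `∑_{m∼M} τ(m)^r ≤ C · M · (log 2M)^{2^{r+1}}` for `M ≥ 1`. [folklore] -/
theorem exists_sum_dyadic_sigma_zero_pow_le (r : ℕ) :
    ∃ C : ℝ, 0 < C ∧ ∀ M : ℝ, 1 ≤ M →
      ∑ m ∈ dyadic M, (σ 0 m : ℝ) ^ r ≤ C * M * Real.log (2 * M) ^ (2 ^ (r + 1)) := by
  obtain ⟨C, hC, h⟩ := exists_sum_sigma_zero_pow_le_real r
  refine ⟨2 * C, by positivity, fun M hM => ?_⟩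
  calc ∑ m ∈ dyadic M, (σ 0 m : ℝ) ^ r ≤ ∑ m ∈ Icc 1 ⌊2 * M⌋₊, (σ 0 m : ℝ) ^ r :=
        Finset.sum_le_sum_of_subset_of_nonneg (dyadic_subset_Icc (by linarith)) fun _ _ _ => by positivity
    _ ≤ C * (2 * M) * Real.log (2 * M) ^ (2 ^ (r + 1)) := h (2 * M) (by linarith)
    _ = 2 * C * M * Real.log (2 * M) ^ (2 ^ (r + 1)) := by ring

/-- `‖α‖₂ ≤ (C M (log 2M)^{c})^{1/2}` for `|α_m| ≤ τ(m)^c` supported on `m ∼ M`: the `ℓ²` norm of a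
divisor-bounded sequence on a dyadic range, `l2Sq M α ≤ C · M · (log 2M)^{2^{2c+1}}`. [folklore] -/
theorem exists_l2Sq_le_of_abs_le_sigma_zero_pow (c : ℕ) :
    ∃ C : ℝ, 0 < C ∧ ∀ M : ℝ, 1 ≤ M → ∀ α : ℕ → ℝ, (∀ m, |α m| ≤ (σ 0 m : ℝ) ^ c) →
      l2Sq M α ≤ C * M * Real.log (2 * M) ^ (2 ^ (2 * c + 1)) := by
  obtain ⟨C, hC, h⟩ := exists_sum_dyadic_sigma_zero_pow_le (2 * c)
  refine ⟨C, hC, fun M hM α hα => le_trans (Finset.sum_le_sum fun m _ => ?_) (h M hM)⟩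
  calc α m ^ 2 = |α m| ^ 2 := (sq_abs _).symm
    _ ≤ ((σ 0 m : ℝ) ^ c) ^ 2 := pow_le_pow_left₀ (abs_nonneg _) (hα m) 2
    _ = (σ 0 m : ℝ) ^ (2 * c) := by rw [← pow_mul, mul_comm]

/-- `‖α‖₁ ≤ C M (log 2M)^{2^{c+1}}` for `|α_m| ≤ τ(m)^c`, summed over `m ∼ M`. [folklore] -/
theorem exists_sum_abs_le_of_abs_le_sigma_zero_pow (c : ℕ) :
    ∃ C : ℝ, 0 < C ∧ ∀ M : ℝ, 1 ≤ M → ∀ α : ℕ → ℝ, (∀ m, |α m| ≤ (σ 0 m : ℝ) ^ c) →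
      ∑ m ∈ dyadic M, |α m| ≤ C * M * Real.log (2 * M) ^ (2 ^ (c + 1)) := by
  obtain ⟨C, hC, h⟩ := exists_sum_dyadic_sigma_zero_pow_le c
  exact ⟨C, hC, fun M hM α hα => le_trans (Finset.sum_le_sum fun m _ => hα m) (h M hM)⟩

end BFI

end Literature.NumberTheory.Sieve
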